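import Literature.NumberTheory.EllipticCurves.WeierstrassChartPoints
import Mathlib.RingTheory.Norm.Basic
import HarnessLib

/-!
# A non-zero function on a Weierstrass cubic has finitely many zeros

Let `W` be a Weierstrass equation over a field `K` and `h ∈ K[W] = K[x, y]/(W(x, y))` a
non-zero element of Mathlib's affine coordinate ring. For every field `L ⊇ K`, **only finitely
many `L`-valued affine points `(x, y)` of `W` satisfy `h(x, y) = 0`**
(`finite_setOf_algHom_apply_eq_zero`, points being the `K`-algebra homomorphisms
`K[W] → L` of `WeierstrassChartPoints.affineAlgHomEquiv`). This is the dimension-one input of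
the "isogeny" dictionary (Silverman, *AEC* II.1–II.2: a non-zero regular function on a curve
has finitely many zeros; III.4.9: a non-zero isogeny has finite kernel), proved here without
dimension theory through the norm of the free rank-two extension `K[x] ⊂ K[W]` (Mathlib
`WeierstrassCurve.Affine.CoordinateRing.norm_smul_basis`, the device of Mathlib's proof that
`K[W]` is a domain):

* `dvd_algebraMap_norm`: `h ∣ N(h)` in `K[W]`, where `N(h) = h · h̄ ∈ K[x]`,
  `h̄ = p - q(y + a₁x + a₃)` for `h = p + qy` (Mathlib `coe_norm_smul_basis`);
* `aeval_norm_eq_zero`: if `φ(h) = 0` for a `K`-algebra map `φ : K[W] → L` then `x = φ(x̄)` is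
  a root of `N(h)`;
* `finite_setOf_algHom_apply_eq_zero`: for `h ≠ 0`, `N(h) ≠ 0` (Mathlib `Algebra.norm_ne_zero_iff`,
  `K[W]` being a domain, free of rank `2` over `K[x]`), so `x` ranges over the finitely many
  roots of `N(h)` in `L`, and for each `x` the coordinate `y = φ(ȳ)` over the at most two roots
  of the monic quadratic `W(x, Y)`; `φ` is determined by `(x, y)`.

## References

* [SilvermanAEC2009] J. H. Silverman, *The Arithmetic of Elliptic Curves*, 2nd ed., GTM 106,
  Springer 2009, II.1–II.2 (zeros of functions on curves), III.4.9.

## Design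

Theorems only (no named facts); `namespace WeierstrassCurve` dot-notation extensions as in the
sibling preludes. The first two lemmas hold over any commutative ring `R`.
-/

noncomputable section

open Polynomial
open scoped Polynomial.Bivariate

universe u v

namespace WeierstrassCurve

variable {R : Type u} [CommRing R] (W : WeierstrassCurve R)

/-- **`h` divides its norm**: for `h = p + q·y ∈ R[W]`, `N(h) = h · (p - q(y + a₁x + a₃))`
in `R[W]` (Mathlib `coe_norm_smul_basis`). [folklore] -/
theorem dvd_algebraMap_norm (h : W.toAffine.CoordinateRing) :
    h ∣ algebraMap R[X] W.toAffine.CoordinateRing (Algebra.norm R[X] h) := by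
  obtain ⟨p, q, rfl⟩ := Affine.CoordinateRing.exists_smul_basis_eq h
  refine ⟨Affine.CoordinateRing.mk W.toAffine
    (C p + C q * (-(Y : R[X][Y]) - C (C W.a₁ * X + C W.a₃))), ?_⟩
  rw [AdjoinRoot.algebraMap_eq, Affine.CoordinateRing.coe_norm_smul_basis, map_mul]
  congr 1
  rw [map_add, map_mul, AdjoinRoot.mk_C, AdjoinRoot.mk_C, AdjoinRoot.mk_X,
    Affine.CoordinateRing.smul, Affine.CoordinateRing.smul, mul_one]
  rfl

variable {S : Type v} [CommRing S] [Algebra R S]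

/-- An `R`-algebra homomorphism `K[W] → S` restricted to `R[x]` is evaluation at the image of
`x̄`. [folklore] -/
theorem algHom_algebraMap (φ : W.toAffine.CoordinateRing →ₐ[R] S) (N : R[X]) :
    φ (algebraMap R[X] W.toAffine.CoordinateRing N) = aeval (φ (xClass W)) N := by
  have hcomp : (φ.comp (IsScalarTower.toAlgHom R R[X] W.toAffine.CoordinateRing)) =
      aeval (φ (xClass W)) := by
    refine Polynomial.algHom_ext ?_
    rw [AlgHom.comp_apply, IsScalarTower.coe_toAlgHom', aeval_X]
    rfl
  exact congrArg (fun ψ : R[X] →ₐ[R] S ↦ ψ N) hcomp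

/-- **If `φ(h) = 0` then `x = φ(x̄)` is a root of the norm `N(h) ∈ R[x]`.** [folklore] -/
theorem aeval_norm_eq_zero (φ : W.toAffine.CoordinateRing →ₐ[R] S) {h : W.toAffine.CoordinateRing}
    (hφ : φ h = 0) : aeval (φ (xClass W)) (Algebra.norm R[X] h) = 0 := by
  obtain ⟨c, hc⟩ := W.dvd_algebraMap_norm h
  rw [← algHom_algebraMap, hc, map_mul, hφ, zero_mul]

/-- The `y`-coordinate of a point `φ : K[W] → S` is a root of the monic quadratic `W(x, Y)`,
`x = φ(x̄)`. [folklore] -/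
theorem isRoot_quadratic (φ : W.toAffine.CoordinateRing →ₐ[R] S) :
    (Polynomial.X ^ 2 + C (algebraMap R S W.a₁ * φ (xClass W) + algebraMap R S W.a₃) * Polynomial.X
      - C (φ (xClass W) ^ 3 + algebraMap R S W.a₂ * φ (xClass W) ^ 2
        + algebraMap R S W.a₄ * φ (xClass W) + algebraMap R S W.a₆)).IsRoot (φ (yClass W)) := by
  have h := (W.equation_baseChange_iff _ _).mp (W.equation_algHom φ)
  simp only [IsRoot.def, eval_sub, eval_add, eval_mul, eval_pow, eval_C, eval_X]
  linear_combination h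

section Field

variable {K : Type u} [Field K] (W : WeierstrassCurve K) (L : Type v) [Field L] [Algebra K L]

/-- The norm of a non-zero element of `K[W]` is non-zero (`K[W]` is a domain, free of rank two
over `K[x]`; Mathlib `Algebra.norm_ne_zero_iff`). [folklore] -/
theorem norm_ne_zero {h : W.toAffine.CoordinateRing} (hh : h ≠ 0) : Algebra.norm K[X] h ≠ 0 := by
  have : Module.Free K[X] W.toAffine.CoordinateRing := .of_basis (Affine.CoordinateRing.basis _)
  have : Module.Finite K[X] W.toAffine.CoordinateRing := .of_basis (Affine.CoordinateRing.basis _)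
  exact Algebra.norm_ne_zero_iff.mpr hh

/-- **A non-zero `h ∈ K[W]` vanishes at only finitely many `L`-valued affine points of `W`**
(`L ⊇ K` any field; points = `K`-algebra homomorphisms `K[W] → L`): the `x`-coordinates are
roots of the non-zero `N(h) ∈ K[x]`, and over each there are at most two `y`'s
(Silverman, *AEC* II.1–II.2). [cite: SilvermanAEC2009, II.2] -/
theorem finite_setOf_algHom_apply_eq_zero {h : W.toAffine.CoordinateRing} (hh : h ≠ 0) :
    {φ : W.toAffine.CoordinateRing →ₐ[K] L | φ h = 0}.Finite := by
  classical
  -- the finitely many possible `x`-coordinates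
  let Nx : Finset L := ((Algebra.norm K[X] h).map (algebraMap K L)).roots.toFinset
  -- and, for each `x`, the finitely many possible `y`-coordinates
  let q : L → L[X] := fun x ↦ Polynomial.X ^ 2 + C (algebraMap K L W.a₁ * x + algebraMap K L W.a₃)
    * Polynomial.X - C (x ^ 3 + algebraMap K L W.a₂ * x ^ 2 + algebraMap K L W.a₄ * x
      + algebraMap K L W.a₆)
  have hq : ∀ x, q x ≠ 0 := fun x ↦ by
    refine Monic.ne_zero ?_
    simp only [q]
    refine Monic.sub_of_left (Monic.add_of_left (monic_X_pow 2) ?_) ?_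
    · exact (degree_C_mul_X_le _).trans_lt (by rw [degree_X_pow]; exact WithBot.coe_lt_coe.mpr (by norm_num))
    · exact degree_C_le.trans_lt (by
        rw [degree_add_eq_left_of_degree_lt ((degree_C_mul_X_le _).trans_lt (by
          rw [degree_X_pow]; exact WithBot.coe_lt_coe.mpr (by norm_num))), degree_X_pow]
        exact WithBot.coe_lt_coe.mpr (by norm_num))
  let T : Set (L × L) := ⋃ x ∈ (Nx : Set L), {x} ×ˢ ((q x).roots.toFinset : Set L)
  have hT : T.Finite := Set.Finite.biUnion (Finset.finite_toSet Nx) fun x _ ↦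
    (Set.finite_singleton x).prod (Finset.finite_toSet _)
  refine Set.Finite.of_finite_image (f := fun φ ↦ (φ (xClass W), φ (yClass W))) (hT.subset ?_) ?_
  · rintro _ ⟨φ, hφ, rfl⟩
    have hx : φ (xClass W) ∈ (Nx : Set L) := by
      rw [Finset.mem_coe, Multiset.mem_toFinset, mem_roots (Polynomial.map_ne_zero (W.norm_ne_zero hh)),
        IsRoot.def, eval_map, ← aeval_def]
      exact W.aeval_norm_eq_zero φ hφ
    refine Set.mem_biUnion hx ⟨rfl, ?_⟩
    rw [Finset.mem_coe, Multiset.mem_toFinset, mem_roots (hq _)]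
    exact W.isRoot_quadratic φ
  · intro φ _ ψ _ hφψ
    obtain ⟨hx, hy⟩ := Prod.mk.inj hφψ
    exact W.affine_algHom_ext hx hy

end Field

end WeierstrassCurve
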